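import Summits.CriticalPhenomena.PercolationContinuityZ3.Theorems.PercNearOneGluingNoHeavyLowerTailQ44bPencilReduction
import Summits.CriticalPhenomena.PercolationContinuityZ3.Theorems.PercNearOneGluingNoHeavyLowerTailFourPointAtoms
import HarnessLib
import HarnessLib.Audit.Tags

/-!
# The single-source packing law `Q44`/SS7 for every finite weighted graph from the LAW-LEVEL hypothesis E-MONO-A

Support file for crux `stmt-CriticalPhenomena-4575` (master-family programme, row `Q44`, full single-source packing of
`prim-bnk-1` gens 27–32), seat `prim-l12-p6` gen 24; memos `run/shared/lean/prim/prim-l12/FROM-prim-bnk-1-gen32-MONO-A.md`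
§header (2c)–(2d) and `run/shared/lean/prim/prim-l12/FROM-prim-l12-p6-g24-EMONOA-SOCKET.md`.

Bond percolation `μ_w = prodBernoulli w` on the pairs of `Fin n`, four marked vertices `a b c y`, `cell w a b c y i` the fifteen
cells of the four-point connectivity law (`FourPointAtoms.cell`; `0 = a|b|c|y, 1 = a|b|cy, 5 = ac|b|y, 6 = ab|c|y, 7 = a|bcy,
8 = ay|bc, 9 = ac|by, 11 = ab|cy, 14 = abcy`).  The **single-source law** (the conclusion of
`TwoCopyMono.pack_singleSource_of_monoA`, stated there under the FIBRE-level hypothesis MONO-A) is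
  `P(ab|c|y)P(a|bcy) + P(ac|b|y)P(a|bcy) + P(ab|cy)P(ac|by) + P(ab|cy)P(ay|bc) + P(ab|c|y)P(ay|bc) + P(ab|c|y)P(a|b|cy)
   + P(ay|bc)P(a|b|cy) ≤ [P(ab|cy)+P(abcy)]·P(a|b|c|y)`.
Its bilinear form in two weightings is `SingleSourceLaw.bil w w'` and the law is `SingleSourceLaw.law w = bil w w ≥ 0`.

* `SingleSourceLaw.law_oneBond` — along the one-bond pencil of a pair `e` (`t = w e`, `w₀ = w[e↦0]`, `w₁ = w[e↦1]`):
  `law w = (1−t)² B(w₀,w₀) + (1−t)t B(w₀,w₁) + t(1−t) B(w₁,w₀) + t² B(w₁,w₁)`.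
* `SingleSourceLaw.EMonoA` — **the law-level hypothesis E-MONO-A** (memo (2c): `Law(G) ≥ q·Law(G−e) + p²·Law(G/e)`, i.e.
  `X ≥ A`): for every weighting and every pair `s(x,z)` whose end `x` is surely joined to `a` in `w[s(x,z)↦0]`,
  `B(w₀,w₀) ≤ B(w₀,w₁) + B(w₁,w₀)`.  It is implied by the fibre count MONO-A (sum over the fibres containing `e`) and is
  equivalent to `prim-bnk-1`'s quadratic 5-point form `Σ V(P,Q) μ₅(P) μ₅(Q) ≥ 0` (kernel `V5_kernel.csv`) up to the gluing identity
  `P_{w₁}(π) = P_{w₀}(π with z glued to the block of a)`.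
* `SingleSourceLaw.pencil_step` — `B(w₀,w₀), B(w₁,w₁) ≥ 0` and E-MONO-A at `e` give `law w ≥ (1−t)B(w₀,w₀) + t²B(w₁,w₁) ≥ 0`.
* `SingleSourceLaw.law_nonneg_of_frozen` — if `P(a~b), P(a~c), P(a~y) ∈ {0,1}` every side product has a vanishing factor
  (each of the seven single-source types joins `a` to a marked point in the cell and separates them in the cocell), so
  `law w = [P(ab|cy)+P(abcy)]·P(∅) ≥ 0`.
* `SingleSourceLaw.law_nonneg_of_eMonoA` — **the reduction**: `EMonoA n a b c y → ∀ w, 0 ≤ law w a b c y`, by induction on the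
  number of pairs with weight in `(0,1)` exactly as `Q44b.row_nonneg_of_pencilConcave` (a fractional pair at `a`'s sure cluster is
  resolved by `pencil_step`; when none is left the cluster of `a` is frozen, `Q44b.real_openConn_zero_or_one`).
* `SingleSourceLaw.pack_singleSource_of_eMonoA` — the law in the literal form of `TwoCopyMono.pack_singleSource_of_monoA`.

So E-MONO-A — a quadratic inequality in the 5-point law of ONE weighted graph, the shape the LP / pseudo-law engines decide — is
now a named LAW-level sufficient hypothesis for the single-source law on every finite weighted graph (the fibre-level socket
being `pack_singleSource_of_monoA`).  Definitions (`bil`, `law`, `EMonoA`) and theorems; no named facts, no sorries, standard axioms.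
-/

noncomputable section

namespace Summit.CriticalPhenomena.PercolationContinuityZ3.Theorems

namespace SingleSourceLaw

open MeasureTheory Set Literature.Probability.LatticeModels Literature.Probability.Percolation
open FourPointAtoms
open Summit.CriticalPhenomena.PercolationContinuityZ3.Cruxes.AdditiveGluing.TieLine.ConnAtoms
open scoped Classical

variable {n : ℕ}

/-! ### The bilinear form and the law -/

/-- The bilinear form of the single-source law in two weightings (copy 1 under `w`, copy 2 under `w'`):
`[P_w(ab|cy)+P_w(abcy)]·P_{w'}(a|b|c|y) − Σ_{seven types (p;q)} P_w(p)·P_{w'}(q)`. [this work] -/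
def bil (w w' : Sym2 (Fin n) → unitInterval) (a b c y : Fin n) : ℝ :=
  (cell w a b c y 11 + cell w a b c y 14) * cell w' a b c y 0 -
    (cell w a b c y 6 * cell w' a b c y 7 + cell w a b c y 5 * cell w' a b c y 7 +
      cell w a b c y 11 * cell w' a b c y 9 + cell w a b c y 11 * cell w' a b c y 8 +
      cell w a b c y 6 * cell w' a b c y 8 + cell w a b c y 6 * cell w' a b c y 1 +
      cell w a b c y 8 * cell w' a b c y 1)

/-- The single-source law as a number: `law w = bil w w` (to be shown `≥ 0`). [this work] -/
def law (w : Sym2 (Fin n) → unitInterval) (a b c y : Fin n) : ℝ := bil w w a b c y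

/-- **E-MONO-A (law level)**: for every weighting `w` and every pair `s(x,z)` (`x ≠ z`) whose end `x` is surely joined to `a`
in `w₀ = w[s(x,z)↦0]`: `B(w₀,w₀) ≤ B(w₀,w₁) + B(w₁,w₀)` with `w₁ = w[s(x,z)↦1]` — "replacing one of the two independent copies on
`G − e` by the copy on `G/e` does not decrease the kernel sum" (`prim-bnk-1` gen 32, memo
`run/shared/lean/prim/prim-l12/FROM-prim-bnk-1-gen32-MONO-A.md` (2c)/(2d); OPEN — 0 failures in > 9·10⁶ fibre instances and
> 6·10³ exact law instances, no proof). [this work] -/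
@[conjecture] def EMonoA (n : ℕ) (a b c y : Fin n) : Prop :=
  ∀ (w : Sym2 (Fin n) → unitInterval) (x z : Fin n), x ≠ z →
    Q44b.sureJoined (Function.update w s(x, z) 0) a x →
      bil (Function.update w s(x, z) 0) (Function.update w s(x, z) 0) a b c y ≤
        bil (Function.update w s(x, z) 0) (Function.update w s(x, z) 1) a b c y +
          bil (Function.update w s(x, z) 1) (Function.update w s(x, z) 0) a b c y

/-! ### The pencil step -/

/-- One-bond expansion of a cell: `cell w i = (1−t)·cell w[e↦0] i + t·cell w[e↦1] i`, `t = w e`. [folklore] -/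
theorem cell_oneBond (w : Sym2 (Fin n) → unitInterval) (e : Sym2 (Fin n)) (a b c y : Fin n) (i : Fin 15) :
    cell w a b c y i =
      (1 - (w e : ℝ)) * cell (Function.update w e 0) a b c y i + (w e : ℝ) * cell (Function.update w e 1) a b c y i := by
  unfold cell
  exact TieLocus.real_oneBond w e _

/-- One-bond expansion of the law: with `t = w e`, `w₀ = w[e↦0]`, `w₁ = w[e↦1]`,
`law w = (1−t)² B(w₀,w₀) + (1−t)t B(w₀,w₁) + t(1−t) B(w₁,w₀) + t² B(w₁,w₁)`. [this work] -/
theorem law_oneBond (w : Sym2 (Fin n) → unitInterval) (e : Sym2 (Fin n)) (a b c y : Fin n) :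
    law w a b c y =
      (1 - (w e : ℝ)) * (1 - (w e : ℝ)) * bil (Function.update w e 0) (Function.update w e 0) a b c y +
        (1 - (w e : ℝ)) * (w e : ℝ) * bil (Function.update w e 0) (Function.update w e 1) a b c y +
        (w e : ℝ) * (1 - (w e : ℝ)) * bil (Function.update w e 1) (Function.update w e 0) a b c y +
        (w e : ℝ) * (w e : ℝ) * bil (Function.update w e 1) (Function.update w e 1) a b c y := by
  unfold law bil
  rw [cell_oneBond w e a b c y 0, cell_oneBond w e a b c y 1, cell_oneBond w e a b c y 5, cell_oneBond w e a b c y 6,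
    cell_oneBond w e a b c y 7, cell_oneBond w e a b c y 8, cell_oneBond w e a b c y 9, cell_oneBond w e a b c y 11,
    cell_oneBond w e a b c y 14]
  ring

/-- **Pencil step**: a quadratic `(1−t)²B₀ + t(1−t)(B₀₁+B₁₀) + t²B₂` on `[0,1]` with `B₀, B₂ ≥ 0` and `B₀ ≤ B₀₁ + B₁₀` is
`≥ (1−t)B₀ + t²B₂ ≥ 0`; hence `0 ≤ law w` from the two ends and E-MONO-A at `e`. [this work] -/
theorem pencil_step (w : Sym2 (Fin n) → unitInterval) (e : Sym2 (Fin n)) (a b c y : Fin n)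
    (h0 : 0 ≤ law (Function.update w e 0) a b c y) (h1 : 0 ≤ law (Function.update w e 1) a b c y)
    (hE : bil (Function.update w e 0) (Function.update w e 0) a b c y ≤
      bil (Function.update w e 0) (Function.update w e 1) a b c y +
        bil (Function.update w e 1) (Function.update w e 0) a b c y) :
    0 ≤ law w a b c y := by
  rw [law_oneBond w e]
  unfold law at h0 h1
  set t : ℝ := (w e : ℝ)
  have ht0 : 0 ≤ t := unitInterval.nonneg (w e)
  have ht1 : t ≤ 1 := unitInterval.le_one (w e)
  set B0 := bil (Function.update w e 0) (Function.update w e 0) a b c y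
  set B2 := bil (Function.update w e 1) (Function.update w e 1) a b c y
  set B01 := bil (Function.update w e 0) (Function.update w e 1) a b c y
  set B10 := bil (Function.update w e 1) (Function.update w e 0) a b c y
  have key : (1 - t) * B0 + t * t * B2 ≤
      (1 - t) * (1 - t) * B0 + (1 - t) * t * B01 + t * (1 - t) * B10 + t * t * B2 := by
    have : (1 - t) * t * B0 ≤ (1 - t) * t * (B01 + B10) :=
      mul_le_mul_of_nonneg_left hE (mul_nonneg (by linarith) ht0)
    nlinarith
  have : 0 ≤ (1 - t) * B0 + t * t * B2 := by positivity
  linarith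

/-! ### Frozen cluster of `a`: the sides vanish -/

/-- A cell whose pattern joins `a` to the marked point `j` lies inside `{a ~ quad j}`. [folklore] -/
theorem cell_le_real_openConn (w : Sym2 (Fin n) → unitInterval) (a b c y : Fin n) (i : Fin 15) (j : Fin 4)
    (hij : pat4 i 0 = pat4 i j) :
    cell w a b c y i ≤ (prodBernoulli w).real (openConn a (quad a b c y j)) := by
  unfold cell
  exact measureReal_mono fun ω hω => ((mem_atom _).1 hω 0 j).2 hij

/-- A cell whose pattern separates `a` from the marked point `j` lies inside `{a ≁ quad j}`. [folklore] -/
theorem cell_le_real_compl_openConn (w : Sym2 (Fin n) → unitInterval) (a b c y : Fin n) (i : Fin 15) (j : Fin 4)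
    (hij : pat4 i 0 ≠ pat4 i j) :
    cell w a b c y i ≤ (prodBernoulli w).real (openConn a (quad a b c y j))ᶜ := by
  unfold cell
  exact measureReal_mono fun ω hω h => hij (((mem_atom _).1 hω 0 j).1 h)

/-- If `P(a ~ quad j) ∈ {0,1}`, a product `cell p · cell q` with `a ~ j` in `p` and `a ≁ j` in `q` vanishes. [this work] -/
theorem cell_mul_cell_eq_zero (w : Sym2 (Fin n) → unitInterval) (a b c y : Fin n) (p q : Fin 15) (j : Fin 4)
    (hp : pat4 p 0 = pat4 p j) (hq : pat4 q 0 ≠ pat4 q j)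
    (hj : (prodBernoulli w).real (openConn a (quad a b c y j)) = 0 ∨
      (prodBernoulli w).real (openConn a (quad a b c y j)) = 1) :
    cell w a b c y p * cell w a b c y q = 0 := by
  rcases hj with h | h
  · have : cell w a b c y p = 0 :=
      le_antisymm (h ▸ cell_le_real_openConn w a b c y p j hp) (cell_nonneg w a b c y p)
    rw [this, zero_mul]
  · have hc : (prodBernoulli w).real (openConn a (quad a b c y j))ᶜ = 0 := by
      rw [Q44b.real_compl, h]; ring
    have : cell w a b c y q = 0 :=
      le_antisymm (hc ▸ cell_le_real_compl_openConn w a b c y q j hq) (cell_nonneg w a b c y q)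
    rw [this, mul_zero]

/-- **Frozen cluster ⇒ the sides vanish and `law ≥ 0`**: if `P(a~b), P(a~c), P(a~y) ∈ {0,1}` then each of the seven side
products has a vanishing factor (types `(6;7),(11;9),(11;8),(6;8),(6;1)` at `b`, `(5;7)` at `c`, `(8;1)` at `y`), and the good
product is nonnegative. [this work] -/
theorem law_nonneg_of_zero_one (w : Sym2 (Fin n) → unitInterval) (a b c y : Fin n)
    (hb : (prodBernoulli w).real (openConn a b) = 0 ∨ (prodBernoulli w).real (openConn a b) = 1)
    (hc : (prodBernoulli w).real (openConn a c) = 0 ∨ (prodBernoulli w).real (openConn a c) = 1)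
    (hy : (prodBernoulli w).real (openConn a y) = 0 ∨ (prodBernoulli w).real (openConn a y) = 1) :
    0 ≤ law w a b c y := by
  have e67 := cell_mul_cell_eq_zero w a b c y 6 7 1 (by decide) (by decide) hb
  have e57 := cell_mul_cell_eq_zero w a b c y 5 7 2 (by decide) (by decide) hc
  have e119 := cell_mul_cell_eq_zero w a b c y 11 9 1 (by decide) (by decide) hb
  have e118 := cell_mul_cell_eq_zero w a b c y 11 8 1 (by decide) (by decide) hb
  have e68 := cell_mul_cell_eq_zero w a b c y 6 8 1 (by decide) (by decide) hb
  have e61 := cell_mul_cell_eq_zero w a b c y 6 1 1 (by decide) (by decide) hb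
  have e81 := cell_mul_cell_eq_zero w a b c y 8 1 3 (by decide) (by decide) hy
  have hg : 0 ≤ (cell w a b c y 11 + cell w a b c y 14) * cell w a b c y 0 :=
    mul_nonneg (add_nonneg (cell_nonneg w a b c y 11) (cell_nonneg w a b c y 14)) (cell_nonneg w a b c y 0)
  unfold law bil
  linarith

/-- **Frozen cluster ⇒ `law ≥ 0`.** [this work] -/
theorem law_nonneg_of_frozen (w : Sym2 (Fin n) → unitInterval) (a b c y : Fin n)
    (hfro : ∀ x z : Fin n, x ≠ z → Q44b.sureJoined w a x → (w s(x, z) = 0 ∨ w s(x, z) = 1)) :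
    0 ≤ law w a b c y :=
  law_nonneg_of_zero_one w a b c y (Q44b.real_openConn_zero_or_one w a hfro b)
    (Q44b.real_openConn_zero_or_one w a hfro c) (Q44b.real_openConn_zero_or_one w a hfro y)

/-! ### The induction on the number of fractional pairs -/

/-- **The reduction.**  E-MONO-A implies `0 ≤ law w` for every weighting `w` on the pairs of `Fin n`: induction on the
number of pairs with weight in `(0,1)`; a fractional pair at `a`'s sure cluster is resolved by `pencil_step`, and when none is
left the cluster of `a` is frozen (`law_nonneg_of_frozen`). [this work] -/
theorem law_nonneg_of_eMonoA (a b c y : Fin n) (hE : EMonoA n a b c y)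
    (w : Sym2 (Fin n) → unitInterval) : 0 ≤ law w a b c y := by
  suffices H : ∀ (k : ℕ) (w : Sym2 (Fin n) → unitInterval), (Q44b.fracPairs w).card ≤ k → 0 ≤ law w a b c y from
    H _ w le_rfl
  intro k
  induction k with
  | zero =>
    intro w hw
    have hfro : ∀ x z : Fin n, x ≠ z → Q44b.sureJoined w a x → (w s(x, z) = 0 ∨ w s(x, z) = 1) := by
      intro x z _ _
      by_contra hne
      push Not at hne
      have : s(x, z) ∈ Q44b.fracPairs w := by
        simp only [Q44b.fracPairs, Finset.mem_filter, Finset.mem_univ, true_and]; exact hne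
      have hpos : 0 < (Q44b.fracPairs w).card := Finset.card_pos.2 ⟨_, this⟩
      omega
    exact law_nonneg_of_frozen w a b c y hfro
  | succ k ih =>
    intro w hw
    by_cases hex : ∃ x z : Fin n, x ≠ z ∧ Q44b.sureJoined w a x ∧ (w s(x, z) ≠ 0 ∧ w s(x, z) ≠ 1)
    · obtain ⟨x, z, hxz, hsure, hfrac⟩ := hex
      have hlt0 := Finset.card_lt_card (Q44b.fracPairs_update_ssubset w hfrac 0 (Or.inl rfl))
      have hlt1 := Finset.card_lt_card (Q44b.fracPairs_update_ssubset w hfrac 1 (Or.inr rfl))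
      have h0 : 0 ≤ law (Function.update w s(x, z) 0) a b c y := ih _ (by omega)
      have h1 : 0 ≤ law (Function.update w s(x, z) 1) a b c y := ih _ (by omega)
      exact pencil_step w s(x, z) a b c y h0 h1 (hE w x z hxz (Q44b.sureJoined_update_zero w hfrac.2 hsure))
    · push Not at hex
      have hfro : ∀ x z : Fin n, x ≠ z → Q44b.sureJoined w a x → (w s(x, z) = 0 ∨ w s(x, z) = 1) := by
        intro x z hxz hs
        by_cases h0 : w s(x, z) = 0
        · exact Or.inl h0
        · exact Or.inr (hex x z hxz hs h0)
      exact law_nonneg_of_frozen w a b c y hfro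

/-- **The single-source law from E-MONO-A, all `n`**, in the literal form of `TwoCopyMono.pack_singleSource_of_monoA`:
`P(ab|c|y)P(a|bcy) + P(ac|b|y)P(a|bcy) + P(ab|cy)P(ac|by) + P(ab|cy)P(ay|bc) + P(ab|c|y)P(ay|bc) + P(ab|c|y)P(a|b|cy)
 + P(ay|bc)P(a|b|cy) ≤ [P(ab|cy)+P(abcy)]·P(a|b|c|y)` on every finite weighted graph on `Fin n`. [this work] -/
theorem pack_singleSource_of_eMonoA (a b c y : Fin n) (hE : EMonoA n a b c y)
    (w : Sym2 (Fin n) → unitInterval) :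
    cell w a b c y 6 * cell w a b c y 7 +
      cell w a b c y 5 * cell w a b c y 7 +
      cell w a b c y 11 * cell w a b c y 9 +
      cell w a b c y 11 * cell w a b c y 8 +
      cell w a b c y 6 * cell w a b c y 8 +
      cell w a b c y 6 * cell w a b c y 1 +
      cell w a b c y 8 * cell w a b c y 1 ≤
      (cell w a b c y 11 + cell w a b c y 14) * cell w a b c y 0 := by
  have h := law_nonneg_of_eMonoA a b c y hE w
  unfold law bil at h
  linarith

/-! ### Appendix (gen 24, second landing): the weaker pencil hypothesis MIX-A

Along the pencil `law w = (1−t)²B₀₀ + t(1−t)(B₀₁+B₁₀) + t²B₁₁` the two ends are the law on graphs with fewer fractional pairs, so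
ANY lower bound on the mixed coefficient `X = B₀₁ + B₁₀` that keeps the quadratic nonnegative closes the induction.  E-MONO-A asks
`X ≥ B₀₀`; the weaker **MIX-A** asks only `X ≥ 0` ("the symmetrised mixed term of the copies on `G − e` and `G/e` is nonnegative",
the single-source analogue of the `Q44b` quantity `MIX` of `…Q44bTwoWeightMonotone`).  At the fibre level `X` is the count of the
fibres of `G` in which `e` is free, so MIX-A is implied by the fibre law itself; at the law level it is the 5-point quadratic inequality
`Σ [k(P⁺,Q) + k(P,Q⁺)] μ₅(P)μ₅(Q) ≥ 0` (memo FROM-prim-l12-p6-g24-EMONOA-SOCKET.md §2; 0 failures / 6·10³ exact laws, minimum 0).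
Since `B₀₀ ≥ 0` is the law for `w[e↦0]`, E-MONO-A ⟹ MIX-A (`mixA_of_eMonoA`), so MIX-A is the weaker named hypothesis. -/

/-- **MIX-A (law level)**: for every weighting `w` and every pair `s(x,z)` (`x ≠ z`) whose end `x` is surely joined to `a` in
`w₀ = w[s(x,z)↦0]`: `0 ≤ B(w₀,w₁) + B(w₁,w₀)` (`w₁ = w[s(x,z)↦1]`).  OPEN (implied by the fibre law / MONO-A; no proof). [this work] -/
@[conjecture] def MixA (n : ℕ) (a b c y : Fin n) : Prop :=
  ∀ (w : Sym2 (Fin n) → unitInterval) (x z : Fin n), x ≠ z →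
    Q44b.sureJoined (Function.update w s(x, z) 0) a x →
      0 ≤ bil (Function.update w s(x, z) 0) (Function.update w s(x, z) 1) a b c y +
        bil (Function.update w s(x, z) 1) (Function.update w s(x, z) 0) a b c y

/-- **Pencil step under MIX-A**: `(1−t)²B₀ + t(1−t)X + t²B₂ ≥ 0` on `[0,1]` as soon as `B₀, B₂, X ≥ 0`. [this work] -/
theorem pencil_step_mix (w : Sym2 (Fin n) → unitInterval) (e : Sym2 (Fin n)) (a b c y : Fin n)
    (h0 : 0 ≤ law (Function.update w e 0) a b c y) (h1 : 0 ≤ law (Function.update w e 1) a b c y)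
    (hX : 0 ≤ bil (Function.update w e 0) (Function.update w e 1) a b c y +
      bil (Function.update w e 1) (Function.update w e 0) a b c y) :
    0 ≤ law w a b c y := by
  rw [law_oneBond w e]
  unfold law at h0 h1
  set t : ℝ := (w e : ℝ)
  have ht0 : 0 ≤ t := unitInterval.nonneg (w e)
  have ht1 : t ≤ 1 := unitInterval.le_one (w e)
  set B0 := bil (Function.update w e 0) (Function.update w e 0) a b c y
  set B2 := bil (Function.update w e 1) (Function.update w e 1) a b c y
  set B01 := bil (Function.update w e 0) (Function.update w e 1) a b c y
  set B10 := bil (Function.update w e 1) (Function.update w e 0) a b c y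
  have h01 : (1 - t) * t * B01 + t * (1 - t) * B10 = (1 - t) * t * (B01 + B10) := by ring
  have hmix : 0 ≤ (1 - t) * t * (B01 + B10) := mul_nonneg (mul_nonneg (by linarith) ht0) hX
  have hA : 0 ≤ (1 - t) * (1 - t) * B0 := mul_nonneg (mul_nonneg (by linarith) (by linarith)) h0
  have hB : 0 ≤ t * t * B2 := mul_nonneg (mul_nonneg ht0 ht0) h1
  linarith

/-- **The reduction under MIX-A**: `MixA n a b c y → ∀ w, 0 ≤ law w a b c y` (same induction on the fractional pairs as
`law_nonneg_of_eMonoA`, with `pencil_step_mix`). [this work] -/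
theorem law_nonneg_of_mixA (a b c y : Fin n) (hM : MixA n a b c y)
    (w : Sym2 (Fin n) → unitInterval) : 0 ≤ law w a b c y := by
  suffices H : ∀ (k : ℕ) (w : Sym2 (Fin n) → unitInterval), (Q44b.fracPairs w).card ≤ k → 0 ≤ law w a b c y from
    H _ w le_rfl
  intro k
  induction k with
  | zero =>
    intro w hw
    have hfro : ∀ x z : Fin n, x ≠ z → Q44b.sureJoined w a x → (w s(x, z) = 0 ∨ w s(x, z) = 1) := by
      intro x z _ _
      by_contra hne
      push Not at hne
      have : s(x, z) ∈ Q44b.fracPairs w := by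
        simp only [Q44b.fracPairs, Finset.mem_filter, Finset.mem_univ, true_and]; exact hne
      have hpos : 0 < (Q44b.fracPairs w).card := Finset.card_pos.2 ⟨_, this⟩
      omega
    exact law_nonneg_of_frozen w a b c y hfro
  | succ k ih =>
    intro w hw
    by_cases hex : ∃ x z : Fin n, x ≠ z ∧ Q44b.sureJoined w a x ∧ (w s(x, z) ≠ 0 ∧ w s(x, z) ≠ 1)
    · obtain ⟨x, z, hxz, hsure, hfrac⟩ := hex
      have hlt0 := Finset.card_lt_card (Q44b.fracPairs_update_ssubset w hfrac 0 (Or.inl rfl))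
      have hlt1 := Finset.card_lt_card (Q44b.fracPairs_update_ssubset w hfrac 1 (Or.inr rfl))
      have h0 : 0 ≤ law (Function.update w s(x, z) 0) a b c y := ih _ (by omega)
      have h1 : 0 ≤ law (Function.update w s(x, z) 1) a b c y := ih _ (by omega)
      exact pencil_step_mix w s(x, z) a b c y h0 h1 (hM w x z hxz (Q44b.sureJoined_update_zero w hfrac.2 hsure))
    · push Not at hex
      have hfro : ∀ x z : Fin n, x ≠ z → Q44b.sureJoined w a x → (w s(x, z) = 0 ∨ w s(x, z) = 1) := by
        intro x z hxz hs
        by_cases h0 : w s(x, z) = 0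
        · exact Or.inl h0
        · exact Or.inr (hex x z hxz hs h0)
      exact law_nonneg_of_frozen w a b c y hfro

/-- **The single-source law from MIX-A, all `n`**, in the literal form of `TwoCopyMono.pack_singleSource_of_monoA`. [this work] -/
theorem pack_singleSource_of_mixA (a b c y : Fin n) (hM : MixA n a b c y)
    (w : Sym2 (Fin n) → unitInterval) :
    cell w a b c y 6 * cell w a b c y 7 +
      cell w a b c y 5 * cell w a b c y 7 +
      cell w a b c y 11 * cell w a b c y 9 +
      cell w a b c y 11 * cell w a b c y 8 +
      cell w a b c y 6 * cell w a b c y 8 +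
      cell w a b c y 6 * cell w a b c y 1 +
      cell w a b c y 8 * cell w a b c y 1 ≤
      (cell w a b c y 11 + cell w a b c y 14) * cell w a b c y 0 := by
  have h := law_nonneg_of_mixA a b c y hM w
  unfold law bil at h
  linarith

/-- **E-MONO-A ⟹ MIX-A**: `B₀₀` is the law for `w[s(x,z)↦0]`, nonnegative under E-MONO-A, and `X ≥ B₀₀`. [this work] -/
theorem mixA_of_eMonoA (a b c y : Fin n) (hE : EMonoA n a b c y) : MixA n a b c y := by
  intro w x z hxz hsure
  have h0 : 0 ≤ law (Function.update w s(x, z) 0) a b c y := law_nonneg_of_eMonoA a b c y hE _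
  unfold law at h0
  have h := hE w x z hxz hsure
  linarith

end SingleSourceLaw

end Summit.CriticalPhenomena.PercolationContinuityZ3.Theorems

end
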